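import Summits.BirchSwinnertonDyer.BirchSwinnertonDyer.Theorems.GenusKolyvaginAtTwoPowDvdShaCardAtTwoRTTwoTermIdentityKolyvagin
import Summits.BirchSwinnertonDyer.BirchSwinnertonDyer.Theorems.GenusKolyvaginAtTwoVisiblePairAtTwoKolyvaginClassSign
import Summits.BirchSwinnertonDyer.BirchSwinnertonDyer.Theorems.GenusKolyvaginAtTwoPowDvdShaCardAtTwoRTGenusKernel
import Summits.BirchSwinnertonDyer.BirchSwinnertonDyer.Theses.GenusKolyvaginAtTwo
import HarnessLib

/-!
# Route `GenusKolyvaginAtTwo`, crux L_T `PowDvdShaCardAtTwoRT` (stmt-BirchSwinnertonDyer-23242), LINE 18 stub KS, the DROPS, input `hrec` —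
# KOLYVAGIN'S TWO-TERM IDENTITY AT `p = 2`, `hrec`-SHAPED: all four exponents are vanishing thresholds of `c_M(n)`, `c_M(nℓ₀)`,
# `c_M(nℓ′)` (the DROPS' `d_T(ℓ)`), the own-prime clauses fed by Q2 `KolyvaginRelationAtTwo`, the signs by Gross 5.4 at `2`

Seat `bsd-line-gk2-p3` g23 (PROVER seat 3/3, cell `bsd-f1-sign2`), `--supports stmt-BirchSwinnertonDyer-23242` (helper; closes nothing).
THEOREMS ONLY (no definition, no named fact, no `sorry`).  BSD is NOT proved by any of this; neither is the crux nor any stub.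

WHAT.  The `hrec` clause of gk2-p2's `PlusDescent.weakSwapOracle_of_twoPrimeReciprocity` reads, with `n = ∏(S∖ℓ₀)`, `S′ = insert ℓ′ (S∖ℓ₀)`
and `d_T(ℓ) = M −` (the exponent `j₀` with «`2^j • c_M(∏T) ∈ torsionLocalKer_λ ⟺ j₀ ≤ j`»):
`d_{S∖ℓ₀}(ℓ′) + d_S(ℓ′) + 2 ≤ M ⟹ d_{S∖ℓ₀}(ℓ′) + d_S(ℓ′) = d_{S∖ℓ₀}(ℓ₀) + d_{S′}(ℓ₀)` (Kolyvagin, Math. Ann. 291 (1991) Thm. 2.1).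
**`exponent_add_eq_of_kolyvaginRelation`** is exactly this, on the route's frame, with Q2 (`KolyvaginRelationAtTwo`, item 24880) as a
displayed NAMED hypothesis (as in LEAD's `…RTMinimaStep` / `…RTKolyvaginMinima`): for data `d` at `n`, `d′` at `nℓ′`, `d₀` at `nℓ₀` compatible
in Q2's sense (Gross's CM construction, `JET.exists_compatible_data_of_grossCM`), thresholds
«`2^j • c_M(nℓ₀) ∈ torsionLocalKer_{λ′} ⟺ A′ ≤ j`» (`A′ = M − d_S(ℓ′)`), «`2^j • c_M(n) ∈ torsionLocalKer_{λ′} ⟺ B′ ≤ j`» (`B′ = M − d_{S∖ℓ₀}(ℓ′)`),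
«`2^j • c_M(nℓ′) ∈ torsionLocalKer_{λ₀} ⟺ A₀ ≤ j`» (`A₀ = M − d_{S′}(ℓ₀)`), «`2^j • c_M(n) ∈ torsionLocalKer_{λ₀} ⟺ B₀ ≤ j`» (`B₀ = M − d_{S∖ℓ₀}(ℓ₀)`):
`M + 2 ≤ A′ + B′ ⟹ A′ + B′ = A₀ + B₀`; `…RTTwoTermIdentity.dl_add_eq_of_twoTerm` / `guard_of_dl_add_two_le` are the (trivial) translation.

HOW.  `…RTTwoTermIdentityKolyvagin.exponent_add_eq_of_kolyvagin_twoTerm_localKer` with: the own-prime `selmerLocalKer`-thresholds of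
`c_M(nℓ′)` at `λ′` and of `c_M(nℓ₀)` at `λ₀` rewritten through BOTH clauses of Q2 into the `torsionLocalKer`-thresholds of `c_M(n)`; the common
sign `ε = −w(E)(−1)^{r}` of `c_M(nℓ′)`, `c_M(nℓ₀)` from `KolyvaginClassSign.sign_conjAct_kolyvaginClass_two` (Gross 5.4 at `2`); `τ² = 1` from
`mul_self_eq_one_of_ne_one`.  What stays displayed: Q2 by name, `FrobEqFrobInfty W K (2^M)` at `ℓ′, ℓ₀` (gk2-p5 `…RTGrossLevelAtTwo` derives it on
the frame from the tower), margin one at every prime, the compatibilities of the three data.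

References: [Kolyvagin1991MathAnn] Thm. 2.1; [McCallumLMS1991] §4 Prop. 4.4, §5 Lemma 5.3 and (13); [GrossLMS1991] Prop. 5.4, Prop. 6.2;
[MilneADT2006] I Thm. 4.10(b).
-/

set_option autoImplicit false

noncomputable section

open scoped Classical
open Function Field NumberField IsDedekindDomain WeierstrassCurve
open Literature.NumberTheory.EllipticCurves Literature.NumberTheory.EllipticCurves.ModularForms
open Literature.NumberTheory.EllipticCurves.RingClassField
open Literature.NumberTheory.GaloisRepresentations Literature.NumberTheory.GaloisCohomology
open Summit.BirchSwinnertonDyer.Rank1Residual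
open Summit.BirchSwinnertonDyer.BirchSwinnertonDyer.Theses.GenusKolyvaginAtTwo (KolyvaginRelationAtTwo)

-- the Theorems namespace of this sub repeats the summit name by design (D-0017 nested layout)
set_option linter.dupNamespace false

namespace Summit.BirchSwinnertonDyer.BirchSwinnertonDyer.Theorems.GenusExact.PlusDescent

variable (W : WeierstrassCurve ℚ) [W.IsElliptic] [W.IsGloballyMinimal] [NeZero (W.conductorNorm ℤ)]
  (K : Type) [Field K] [NumberField K]

/-- **KOLYVAGIN'S TWO-TERM IDENTITY at `p = 2` over the Heegner field, `hrec`-shaped** (see the module docstring): on the route's frame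
with Q2 `KolyvaginRelationAtTwo` as a named hypothesis, for compatible data `d` at `n`, `d′` at `nℓ′`, `d₀` at `nℓ₀` (square-free products
of Zhang–Kolyvagin primes at `2` of index `≥ M + 1`, `FrobEqFrobInfty W K (2^M)` at `ℓ′, ℓ₀`) and the four `torsionLocalKer`-thresholds
`A′` (of `c_M(nℓ₀)` at `λ′`), `B′` (of `c_M(n)` at `λ′`), `A₀` (of `c_M(nℓ′)` at `λ₀`), `B₀` (of `c_M(n)` at `λ₀`):
`M + 2 ≤ A′ + B′ ⟹ A′ + B′ = A₀ + B₀`.  [cite: Kolyvagin1991MathAnn, Thm. 2.1] [cite: McCallumLMS1991, §4 Prop. 4.4, §5 (13)]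
[cite: GrossLMS1991, Prop. 5.4 and Prop. 6.2] -/
theorem exponent_add_eq_of_kolyvaginRelation (hQ2 : KolyvaginRelationAtTwo) (hcm : ¬ W.HasCM)
    (hsurj : ∀ k : ℕ, W.HasSurjectiveModNGaloisRep ((2 ^ k : ℕ) : ℤ)) (hc : Odd W.tamagawaProduct) (hΔ : W.Δ < 0)
    (hK : IsImaginaryQuadratic K) (hodd : Odd (NumberField.discr K)) (hD3 : NumberField.discr K ≠ -3)
    (hH : SatisfiesHeegnerHypothesis (W.conductorNorm ℤ) K)
    (Dt : ModularParametrizationData W (W.conductorNorm ℤ)) (β : ℤ) (ι : K →+* ℂ)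
    [∀ j : ℕ, NumberField (ringClassField K ι j)] {M : ℕ} (hM : 1 ≤ M) {τ : K ≃ₐ[ℚ] K} (hτ1 : τ ≠ 1)
    {n ℓ' ℓ₀ : ℕ} (hℓ'p : ℓ'.Prime) (hℓ₀p : ℓ₀.Prime) (hne : ℓ' ≠ ℓ₀)
    (hc' : KolyvaginDescent.KolSupp (Zhang2014.IsKolyvaginPrime (W.conductorNorm ℤ) W K 2) (n * ℓ'))
    (hc₀ : KolyvaginDescent.KolSupp (Zhang2014.IsKolyvaginPrime (W.conductorNorm ℤ) W K 2) (n * ℓ₀))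
    (hc'M : ∀ q ∈ (n * ℓ').primeFactors, M + 1 ≤ Zhang2014.kolyvaginIndex W 2 q)
    (hc₀M : ∀ q ∈ (n * ℓ₀).primeFactors, M + 1 ≤ Zhang2014.kolyvaginIndex W 2 q)
    (hF' : FrobEqFrobInfty W K (2 ^ M) ℓ') (hF₀ : FrobEqFrobInfty W K (2 ^ M) ℓ₀)
    (d : KolyvaginHeegnerData Dt β ι n)
    (d' : KolyvaginHeegnerData Dt β ι (n * ℓ')) (d₀ : KolyvaginHeegnerData Dt β ι (n * ℓ₀))
    -- compatibility of `d′` with `d` (Q2's binders verbatim)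
    (hσ' : ∀ q ∈ n.primeFactors, ∀ (x : ringClassField K ι n) (x' : ringClassField K ι (n * ℓ')), (x : ℂ) = x' →
      ((d'.σ q x' : ringClassField K ι (n * ℓ')) : ℂ) = (d.σ q x : ℂ))
    (hS' : ∀ s ∈ d.S, ∃ s' ∈ d'.S, ∀ (x : ringClassField K ι n) (x' : ringClassField K ι (n * ℓ')), (x : ℂ) = x' →
      ((s' x' : ringClassField K ι (n * ℓ')) : ℂ) = (s x : ℂ))
    (hS'' : ∀ s' ∈ d'.S, ∃ s ∈ d.S, ∀ (x : ringClassField K ι n) (x' : ringClassField K ι (n * ℓ')), (x : ℂ) = x' →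
      ((s' x' : ringClassField K ι (n * ℓ')) : ℂ) = (s x : ℂ))
    (hemb' : ∀ (x : ringClassField K ι n) (x' : ringClassField K ι (n * ℓ')), (x : ℂ) = x' → d'.emb x' = d.emb x)
    -- compatibility of `d₀` with `d`
    (hσ₀ : ∀ q ∈ n.primeFactors, ∀ (x : ringClassField K ι n) (x' : ringClassField K ι (n * ℓ₀)), (x : ℂ) = x' →
      ((d₀.σ q x' : ringClassField K ι (n * ℓ₀)) : ℂ) = (d.σ q x : ℂ))
    (hS₀ : ∀ s ∈ d.S, ∃ s' ∈ d₀.S, ∀ (x : ringClassField K ι n) (x' : ringClassField K ι (n * ℓ₀)), (x : ℂ) = x' →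
      ((s' x' : ringClassField K ι (n * ℓ₀)) : ℂ) = (s x : ℂ))
    (hS₀' : ∀ s' ∈ d₀.S, ∃ s ∈ d.S, ∀ (x : ringClassField K ι n) (x' : ringClassField K ι (n * ℓ₀)), (x : ℂ) = x' →
      ((s' x' : ringClassField K ι (n * ℓ₀)) : ℂ) = (s x : ℂ))
    (hemb₀ : ∀ (x : ringClassField K ι n) (x' : ringClassField K ι (n * ℓ₀)), (x : ℂ) = x' → d₀.emb x' = d.emb x)
    (w' w₀ : HeightOneSpectrum (𝓞 K)) (hw' : (ℓ' : 𝓞 K) ∈ w'.asIdeal) (hw₀ : (ℓ₀ : 𝓞 K) ∈ w₀.asIdeal)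
    {A' B' A₀ B₀ : ℕ}
    (hA' : ∀ j : ℕ, ((2 ^ j : ℕ) : ℤ) • d₀.kolyvaginClass Nat.prime_two M ∈
      (W.baseChange K).torsionLocalKer (w'.adicCompletion K) ((2 ^ M : ℕ) : ℤ) ↔ A' ≤ j)
    (hB' : ∀ j : ℕ, ((2 ^ j : ℕ) : ℤ) • d.kolyvaginClass Nat.prime_two M ∈
      (W.baseChange K).torsionLocalKer (w'.adicCompletion K) ((2 ^ M : ℕ) : ℤ) ↔ B' ≤ j)
    (hA₀ : ∀ j : ℕ, ((2 ^ j : ℕ) : ℤ) • d'.kolyvaginClass Nat.prime_two M ∈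
      (W.baseChange K).torsionLocalKer (w₀.adicCompletion K) ((2 ^ M : ℕ) : ℤ) ↔ A₀ ≤ j)
    (hB₀ : ∀ j : ℕ, ((2 ^ j : ℕ) : ℤ) • d.kolyvaginClass Nat.prime_two M ∈
      (W.baseChange K).torsionLocalKer (w₀.adicCompletion K) ((2 ^ M : ℕ) : ℤ) ↔ B₀ ≤ j)
    (hguard : M + 2 ≤ A' + B') :
    A' + B' = A₀ + B₀ := by
  -- ### frame numerics
  have hD4 : NumberField.discr K ≠ -4 := fun h ↦ by
    rw [h] at hodd
    exact (Int.not_even_iff_odd.mpr hodd) ⟨-2, by norm_num⟩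
  have hD : NumberField.discr K < -4 := X11b.KolyvaginAssembly.discr_lt_neg_four hK ⟨hD3, hD4⟩
  have hsurj1 : W.HasSurjectiveModNGaloisRep ((2 : ℤ) ^ 1) := by exact_mod_cast hsurj 1
  have hττ : τ * τ = 1 := mul_self_eq_one_of_ne_one K hK.1 τ hτ1
  -- ### the two conductors
  have hn0 : n ≠ 0 := by
    rintro rfl
    exact hc'.1.ne_zero (zero_mul _)
  have hℓ'c' : ℓ' ∈ (n * ℓ').primeFactors :=
    Nat.mem_primeFactors.mpr ⟨hℓ'p, dvd_mul_left _ _, mul_ne_zero hn0 hℓ'p.ne_zero⟩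
  have hℓ₀c₀ : ℓ₀ ∈ (n * ℓ₀).primeFactors :=
    Nat.mem_primeFactors.mpr ⟨hℓ₀p, dvd_mul_left _ _, mul_ne_zero hn0 hℓ₀p.ne_zero⟩
  have hk'all : ∀ q ∈ (n * ℓ').primeFactors,
      Zhang2014.IsKolyvaginPrime (W.conductorNorm ℤ) W K 2 q ∧ M ≤ Zhang2014.kolyvaginIndex W 2 q :=
    fun q hq ↦ ⟨hc'.2 q hq, by have h := hc'M q hq; omega⟩
  have hk₀all : ∀ q ∈ (n * ℓ₀).primeFactors,
      Zhang2014.IsKolyvaginPrime (W.conductorNorm ℤ) W K 2 q ∧ M ≤ Zhang2014.kolyvaginIndex W 2 q :=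
    fun q hq ↦ ⟨hc₀.2 q hq, by have h := hc₀M q hq; omega⟩
  have hℓ'n : ¬ ℓ' ∣ n := by
    rintro ⟨m, rfl⟩
    exact hℓ'p.one_lt.ne' (Nat.isUnit_iff.mp (hc'.1 ℓ' ⟨m, by ring⟩))
  have hℓ₀n : ¬ ℓ₀ ∣ n := by
    rintro ⟨m, rfl⟩
    exact hℓ₀p.one_lt.ne' (Nat.isUnit_iff.mp (hc₀.1 ℓ₀ ⟨m, by ring⟩))
  -- ### the common sign of `c_M(nℓ′)` and `c_M(nℓ₀)` (Gross 5.4 at `2`)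
  -- (`#primeFactors(nℓ) = #primeFactors(n) + 1` for both fresh primes; cf. KRR `RegularWalk.card_primeFactors_mul_of_not_dvd`)
  have hcard1 : ∀ {ℓ : ℕ}, ℓ.Prime → ¬ ℓ ∣ n → (n * ℓ).primeFactors.card = n.primeFactors.card + 1 := fun {ℓ} hℓ hℓn ↦ by
    rw [Nat.primeFactors_mul hn0 hℓ.ne_zero, hℓ.primeFactors,
      Finset.card_union_of_disjoint (Finset.disjoint_singleton_right.mpr fun h ↦ hℓn (Nat.dvd_of_mem_primeFactors h)),
      Finset.card_singleton]
  have hcard : (n * ℓ').primeFactors.card = (n * ℓ₀).primeFactors.card := by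
    rw [hcard1 hℓ'p hℓ'n, hcard1 hℓ₀p hℓ₀n]
  obtain ⟨hε, hx⟩ := KolyvaginClassSign.sign_conjAct_kolyvaginClass_two hK hD3 hD4 hodd hH hsurj1 τ hτ1 Dt β ι hc'.1 hM
    hk'all d'
  obtain ⟨-, hy⟩ := KolyvaginClassSign.sign_conjAct_kolyvaginClass_two hK hD3 hD4 hodd hH hsurj1 τ hτ1 Dt β ι hc₀.1 hM
    hk₀all d₀
  rw [← hcard] at hy
  -- ### Q2 at the own primes: `selmerLocalKer`-thresholds of `c_M(nℓ′)` at `λ′`, of `c_M(nℓ₀)` at `λ₀` = those of `c_M(n)`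
  have hQ' := hQ2 W hcm K hK hD3 hD4 hH hsurj Dt β ι M hM n ℓ' hc'.1 hℓ'p hℓ'n hk'all d d' hσ' hS' hS'' hemb' w' hw'
  have hQ₀ := hQ2 W hcm K hK hD3 hD4 hH hsurj Dt β ι M hM n ℓ₀ hc₀.1 hℓ₀p hℓ₀n hk₀all d d₀ hσ₀ hS₀ hS₀' hemb₀ w₀ hw₀
  have hB's : ∀ j : ℕ, ((2 ^ j : ℕ) : ℤ) • d'.kolyvaginClass Nat.prime_two M ∈
      selmerLocalKer (W.baseChange K) (w'.adicCompletion K) ((2 ^ M : ℕ) : ℤ) ↔ B' ≤ j :=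
    fun j ↦ (hQ' j).1.trans (((hQ' j).2).trans (hB' j))
  have hB₀s : ∀ j : ℕ, ((2 ^ j : ℕ) : ℤ) • d₀.kolyvaginClass Nat.prime_two M ∈
      selmerLocalKer (W.baseChange K) (w₀.adicCompletion K) ((2 ^ M : ℕ) : ℤ) ↔ B₀ ≤ j :=
    fun j ↦ (hQ₀ j).1.trans (((hQ₀ j).2).trans (hB₀ j))
  -- ### the two-term identity
  exact exponent_add_eq_of_kolyvagin_twoTerm_localKer W K hsurj hc hK hD hΔ hH Dt β ι hM hτ1 hττ hℓ'p hℓ₀p hne hc' hc₀ hc'M hc₀M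
    hF' hF₀ d' d₀ w' w₀ hw' hw₀ hε hx hy hA' hB's hA₀ hB₀s hguard

/-- **The same in the DROPS' divisibility currency** (`dᵢ ≤ M`; `d₁ = d_{S∖ℓ₀}(ℓ′)`, `d₂ = d_S(ℓ′)`, `d₃ = d_{S∖ℓ₀}(ℓ₀)`, `d₄ = d_{S′}(ℓ₀)`,
thresholds `M − dᵢ`): `d₁ + d₂ + 2 ≤ M ⟹ d₁ + d₂ = d₃ + d₄` — literally the `hrec` clause of
`PlusDescent.weakSwapOracle_of_twoPrimeReciprocity`, for one swap, on the route's frame with Q2 by name.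
[cite: Kolyvagin1991MathAnn, Thm. 2.1] [cite: McCallumLMS1991, §5 (13)] -/
theorem dl_add_eq_of_kolyvaginRelation (hQ2 : KolyvaginRelationAtTwo) (hcm : ¬ W.HasCM)
    (hsurj : ∀ k : ℕ, W.HasSurjectiveModNGaloisRep ((2 ^ k : ℕ) : ℤ)) (hc : Odd W.tamagawaProduct) (hΔ : W.Δ < 0)
    (hK : IsImaginaryQuadratic K) (hodd : Odd (NumberField.discr K)) (hD3 : NumberField.discr K ≠ -3)
    (hH : SatisfiesHeegnerHypothesis (W.conductorNorm ℤ) K)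
    (Dt : ModularParametrizationData W (W.conductorNorm ℤ)) (β : ℤ) (ι : K →+* ℂ)
    [∀ j : ℕ, NumberField (ringClassField K ι j)] {M : ℕ} (hM : 1 ≤ M) {τ : K ≃ₐ[ℚ] K} (hτ1 : τ ≠ 1)
    {n ℓ' ℓ₀ : ℕ} (hℓ'p : ℓ'.Prime) (hℓ₀p : ℓ₀.Prime) (hne : ℓ' ≠ ℓ₀)
    (hc' : KolyvaginDescent.KolSupp (Zhang2014.IsKolyvaginPrime (W.conductorNorm ℤ) W K 2) (n * ℓ'))
    (hc₀ : KolyvaginDescent.KolSupp (Zhang2014.IsKolyvaginPrime (W.conductorNorm ℤ) W K 2) (n * ℓ₀))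
    (hc'M : ∀ q ∈ (n * ℓ').primeFactors, M + 1 ≤ Zhang2014.kolyvaginIndex W 2 q)
    (hc₀M : ∀ q ∈ (n * ℓ₀).primeFactors, M + 1 ≤ Zhang2014.kolyvaginIndex W 2 q)
    (hF' : FrobEqFrobInfty W K (2 ^ M) ℓ') (hF₀ : FrobEqFrobInfty W K (2 ^ M) ℓ₀)
    (d : KolyvaginHeegnerData Dt β ι n)
    (d' : KolyvaginHeegnerData Dt β ι (n * ℓ')) (d₀ : KolyvaginHeegnerData Dt β ι (n * ℓ₀))
    (hσ' : ∀ q ∈ n.primeFactors, ∀ (x : ringClassField K ι n) (x' : ringClassField K ι (n * ℓ')), (x : ℂ) = x' →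
      ((d'.σ q x' : ringClassField K ι (n * ℓ')) : ℂ) = (d.σ q x : ℂ))
    (hS' : ∀ s ∈ d.S, ∃ s' ∈ d'.S, ∀ (x : ringClassField K ι n) (x' : ringClassField K ι (n * ℓ')), (x : ℂ) = x' →
      ((s' x' : ringClassField K ι (n * ℓ')) : ℂ) = (s x : ℂ))
    (hS'' : ∀ s' ∈ d'.S, ∃ s ∈ d.S, ∀ (x : ringClassField K ι n) (x' : ringClassField K ι (n * ℓ')), (x : ℂ) = x' →
      ((s' x' : ringClassField K ι (n * ℓ')) : ℂ) = (s x : ℂ))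
    (hemb' : ∀ (x : ringClassField K ι n) (x' : ringClassField K ι (n * ℓ')), (x : ℂ) = x' → d'.emb x' = d.emb x)
    (hσ₀ : ∀ q ∈ n.primeFactors, ∀ (x : ringClassField K ι n) (x' : ringClassField K ι (n * ℓ₀)), (x : ℂ) = x' →
      ((d₀.σ q x' : ringClassField K ι (n * ℓ₀)) : ℂ) = (d.σ q x : ℂ))
    (hS₀ : ∀ s ∈ d.S, ∃ s' ∈ d₀.S, ∀ (x : ringClassField K ι n) (x' : ringClassField K ι (n * ℓ₀)), (x : ℂ) = x' →
      ((s' x' : ringClassField K ι (n * ℓ₀)) : ℂ) = (s x : ℂ))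
    (hS₀' : ∀ s' ∈ d₀.S, ∃ s ∈ d.S, ∀ (x : ringClassField K ι n) (x' : ringClassField K ι (n * ℓ₀)), (x : ℂ) = x' →
      ((s' x' : ringClassField K ι (n * ℓ₀)) : ℂ) = (s x : ℂ))
    (hemb₀ : ∀ (x : ringClassField K ι n) (x' : ringClassField K ι (n * ℓ₀)), (x : ℂ) = x' → d₀.emb x' = d.emb x)
    (w' w₀ : HeightOneSpectrum (𝓞 K)) (hw' : (ℓ' : 𝓞 K) ∈ w'.asIdeal) (hw₀ : (ℓ₀ : 𝓞 K) ∈ w₀.asIdeal)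
    {d₁ d₂ d₃ d₄ : ℕ} (h₁ : d₁ ≤ M) (h₂ : d₂ ≤ M) (h₃ : d₃ ≤ M) (h₄ : d₄ ≤ M)
    (hA' : ∀ j : ℕ, ((2 ^ j : ℕ) : ℤ) • d₀.kolyvaginClass Nat.prime_two M ∈
      (W.baseChange K).torsionLocalKer (w'.adicCompletion K) ((2 ^ M : ℕ) : ℤ) ↔ M - d₂ ≤ j)
    (hB' : ∀ j : ℕ, ((2 ^ j : ℕ) : ℤ) • d.kolyvaginClass Nat.prime_two M ∈
      (W.baseChange K).torsionLocalKer (w'.adicCompletion K) ((2 ^ M : ℕ) : ℤ) ↔ M - d₁ ≤ j)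
    (hA₀ : ∀ j : ℕ, ((2 ^ j : ℕ) : ℤ) • d'.kolyvaginClass Nat.prime_two M ∈
      (W.baseChange K).torsionLocalKer (w₀.adicCompletion K) ((2 ^ M : ℕ) : ℤ) ↔ M - d₄ ≤ j)
    (hB₀ : ∀ j : ℕ, ((2 ^ j : ℕ) : ℤ) • d.kolyvaginClass Nat.prime_two M ∈
      (W.baseChange K).torsionLocalKer (w₀.adicCompletion K) ((2 ^ M : ℕ) : ℤ) ↔ M - d₃ ≤ j)
    (hguard : d₁ + d₂ + 2 ≤ M) :
    d₁ + d₂ = d₃ + d₄ := by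
  have h := exponent_add_eq_of_kolyvaginRelation W K hQ2 hcm hsurj hc hΔ hK hodd hD3 hH Dt β ι hM hτ1 hℓ'p hℓ₀p hne hc' hc₀
    hc'M hc₀M hF' hF₀ d d' d₀ hσ' hS' hS'' hemb' hσ₀ hS₀ hS₀' hemb₀ w' w₀ hw' hw₀ hA' hB' hA₀ hB₀ (by omega)
  omega

end Summit.BirchSwinnertonDyer.BirchSwinnertonDyer.Theorems.GenusExact.PlusDescent

end
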